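import Summits.BirchSwinnertonDyer.BirchSwinnertonDyer.Theses.PrintCf2
import Summits.BirchSwinnertonDyer.BirchSwinnertonDyer.Theorems.PrintCf2MaximalOrderReduction
import Summits.BirchSwinnertonDyer.Rank1Residual.P2.SplitBadTwistTypes
import HarnessLib

/-!
# Crux `PrintCf2.SplitBadTwoRankOneOfFacts` (item stmt-BirchSwinnertonDyer-20368) — line `ltyz-zeta8-trichotomy`
# (ideator seat bsd-idea-7, lens «complete» = program-completion: Li–Tian–Yan–Zhu 2025 approach (II) at ADDITIVE 2)

HONEST FRAMING. Nothing is proved about BSD here: TWO `sorry`'d stubs (2, 3), stub 1 CLOSED by the kernel theorem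
`Summit.BirchSwinnertonDyer.Rank1Residual.P2.SplitBadTwistTypes.twistTypeTrichotomy_stub` (ty2 g12, p604911; lead's skeleton
registered 2026-08-28T05:06:53Z as sha 8f920729167b, superseding 134b4d5cb357 stub-for-stub), and one kernel-checked composition
`SplitBadTwoRankOneOfFacts_of : SplitBadTwoRankOneOfFacts` (proof = the three stubs by name). BSD is not proved by any of this.

THE CLASS. CM by `ℚ(√−7)`, `r_an = 1`, `2` split, BAD at `2`: the minimal models of `49a1^{(d)}` (and their `2`-isogenous
`49a2`-partners), `d` square-free, `d ≢ 1 (mod 4)`; by `Theorems.PrintCf2.wAllCornerFTwoSplitBad_iff_maximal` (Cassels +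
GZK + modularity, all conjuncts of the crux's own bundle `𝔅_split`) it suffices to treat `j = −3375`.

THE PROGRAMME AND ITS AUTHOR-NAMED GAP. LTYZ 2025 (doi:10.4310/pamq.251115004959; authors' version pp. 2–3, §1.3 (II);
§6 p. 11 "We assume that E has good ordinary reduction at p when p = 2"; §7 p. 14 "potentially good (resp. good) ordinary
reduction at p for p odd (resp. p = 2)"; Thm 7.2 (Yager) "Assume that F = K if p = 2"; [35] = Y. Li 2025 (F = K), [34]
forthcoming (F/K unramified at 2)): the even case is proved only for `D ≡ 1 (mod 4)` because (a) the two-variable →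
cyclotomic main-conjecture transfer (Prop. 7.5, tree: `LiTianYanZhu2025.prop75_charIdeal_selmerDual_cyclotomic_eq_katzLines`,
binders `HasGoodReductionAtPrime 2 ∧ ¬ 2 ∣ a₂`) uses Yager's theorem over a base UNRAMIFIED at `2`, and (b) the algebraic
leading-term formula (Thm 6.1) descends through `F = K(E_{𝔭²})` over which `E` must be good EVERYWHERE (Lemma 3.4).

THE LEVER OF THIS LINE (new on this crux). Every member `E = A^{(d)}` acquires good ORDINARY reduction above `2` over
`K(μ₈) = K(i, √2)` (the `2`-adic inertia character of `E` is `χ_d|ℤ₂ˣ`, of conductor `4` or `8`, hence a character of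
`(ℤ/8)ˣ = Gal(ℚ(ζ₈)/ℚ)`). Exactly ONE of the three quadratic subfields `ℚ(√2), ℚ(i), ℚ(√−2)` of `ℚ(ζ₈)` already does it —
equivalently exactly one of the twists `E^{(2)}, E^{(−1)}, E^{(−2)}` is good at `2` (`d ≡ 2 (mod 8)`, `d ≡ 3 (mod 4)`,
`d ≡ 6 (mod 8)` respectively) — and the three behave differently with respect to LTYZ's towers:
* `√2 ∈ K^{cyc}` (first layer of the cyclotomic `ℤ₂`-extension of `K`; `w_K = 2` makes `Gal(K(𝔭^∞)/K) = ℤ₂ˣ/±1`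
  torsion-free, so the inertia characters available INSIDE the `ℤ₂²`-tower of `K` are exactly the even ones, `χ_2`-type):
  for `d ≡ 2 (mod 8)`, `Sel_{2^∞}(E/K^{cyc}) = Sel_{2^∞}(E^{(2)}/K^{cyc}) ⊗ χ_2` with `χ_2` a character OF `Γ = Gal(K^{cyc}/K)`,
  so Prop. 7.5 for the GOOD ORDINARY curve `E^{(2)}` (in print, any rank) transports to `E` by the `Λ`-automorphism
  `γ ↦ χ_2(γ)γ`; what remains is the Schneider–Perrin-Riou descent `K^{cyc} → K` through an additive fibre that turns good
  at layer 1 (one new local index at `v ∣ 2`) and the `2`-adic Gross–Zagier step, which LTYZ Thm 8.2 (Disegni [18] +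
  Yuan–Zhang–Zhang [53], Bertrand [2]) already states for POTENTIALLY good ordinary `p` — stub `stub_cyclotomicInternalType`;
* `i, √−2 ∉ K_∞` (odd inertia type): `E` becomes good only over `K(μ₄)` resp. `K(√−2)`, quadratic over `K`, RAMIFIED at `2`
  and outside the `ℤ₂²`-tower; the transfer needs the two-variable main conjecture + Yager over a base ramified at `2`
  (beyond [35], [34]) or, equivalently, a `Δ = Gal(K(μ₄)/K)`-EQUIVARIANT (non-semisimple, `2 = #Δ`) descent from
  `K(μ_{2^∞})`; the one-variable `𝔭`-adic main conjecture at `2` for EVERY finite abelian `L/K` (K. Müller 2020,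
  arXiv:2002.05647 Thm 1.1, `L ⊂ K(𝔣𝔭²)` allowed) is the printed input nearest to it — stub `stub_cyclotomicExternalType`.
Stub `stub_twistTypeTrichotomy` is the classifier (Tate's algorithm on the twist family; S-sized, cheapest falsifier).

PRINTED INPUTS beyond `𝔅_split` that the proof plans use (K7t doctrine: a prover needing them gets an `…OfFactsPlus` twin,
exactly as for the crux itself): LTYZ Prop. 7.5 / (7.1) (typed), LTYZ Thm 8.2 (Disegni 2017 + YZZ 2013; not typed at
`p = 2`), Greenberg App. I (no finite submodules), Müller 2020 (not typed). Barriers: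
`Literature.Barriers.BirchSwinnertonDyer.AdditiveIwasawaTheoryAtTwoBarrier` applies to cyclotomic theory OVER `ℚ` at an
additive `2`; this line works over `K^{cyc}`/`K(μ_{2^∞})` where the curve is good ordinary from layer ≤ 2 on (evasion (i):
base change to semistability INSIDE the tower). `TwoDescentDefectUnbounded`: no fixed-level descent is used.
-/

set_option linter.dupNamespace false

open WeierstrassCurve Literature.NumberTheory.EllipticCurves Literature.NumberTheory.EllipticCurves.Rank1Residual

namespace Summit.BirchSwinnertonDyer.BirchSwinnertonDyer.Cruxes.SplitBadTwoRankOneOfFacts.LtyzZeta8Trichotomy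

open Summit.BirchSwinnertonDyer.BirchSwinnertonDyer.Theses.PrintCf2

/-- **Stub 1 (classifier; S-sized).** A globally minimal `W/ℚ` with `j = −3375` and bad reduction at `2` is a twist
`49a1^{(d)}`, `d ≢ 1 (mod 4)` (tree: `exists_squarefree_twist_of_j_neg3375_of_not_good_two`), and then exactly one of
`d ≡ 2 (mod 8)`, `d ≡ 3 (mod 4)`, `d ≡ 6 (mod 8)` holds, i.e. (at least) one of the twists `W^{(2)}`, `W^{(−1)}`,
`W^{(−2)}` — squarefree parts `d/2`, `−d`, `−d/2` — has a globally minimal model with GOOD reduction at `2`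
(`49a1^{(m)}` is good at `2` iff `m ≡ 1 (mod 4)`). Tate's algorithm / the tree's twist currency; no Iwasawa theory.
Why it might fail: only by a slip in the `2`-adic bookkeeping of `quadraticTwist` models (cheapest falsifier: `d = −1, −2,
−5, −6, −10` against LMFDB labels 784.*, 3136.*, 19600.*). -/
theorem stub_twistTypeTrichotomy :
    ∀ (W : WeierstrassCurve ℚ) [W.IsElliptic] [W.IsGloballyMinimal], W.j = -3375 → ¬ Good W 2 →
      (∃ (W' : WeierstrassCurve ℚ) (_ : W'.IsElliptic) (_ : W'.IsGloballyMinimal) (C : VariableChange ℚ),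
          C • W.quadraticTwist (2 : ℚ) = W' ∧ Good W' 2) ∨
      (∃ (W' : WeierstrassCurve ℚ) (_ : W'.IsElliptic) (_ : W'.IsGloballyMinimal) (C : VariableChange ℚ),
          C • W.quadraticTwist (-1 : ℚ) = W' ∧ Good W' 2) ∨
      (∃ (W' : WeierstrassCurve ℚ) (_ : W'.IsElliptic) (_ : W'.IsGloballyMinimal) (C : VariableChange ℚ),
          C • W.quadraticTwist (-2 : ℚ) = W' ∧ Good W' 2) :=
  -- stub 1 CLOSED (ty2 g12, p604911): the registered signature verbatim
  Summit.BirchSwinnertonDyer.Rank1Residual.P2.SplitBadTwistTypes.twistTypeTrichotomy_stub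

/-- **Stub 2 (the CYCLOTOMIC-INTERNAL type `d ≡ 2 (mod 8)`: LTYZ (II) completed inside `K^{cyc}`; M/L-sized, the line's
first target).** Relative to `𝔅_split`: every globally minimal `W` of analytic rank one with `j = −3375`, bad at `2`,
whose twist by `2` is good at `2`, satisfies `BSD(W,2)`. Plan: `W ≅ W^{(2)} ⊗ χ_2` over `K = ℚ(√−7)` with `χ_2` the
order-`2` character of `Γ = Gal(K^{cyc}/K)` (`ℚ(√2) ⊂ ℚ^{cyc}`); (i) `X(W/K^{cyc}) = X(W^{(2)}/K^{cyc}) ⊗ χ_2`, so the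
cyclotomic main identity (LTYZ Prop. 7.5 = `prop75_charIdeal_selmerDual_cyclotomic_eq_katzLines` for the GOOD ORDINARY
CM curve `W^{(2)}`, no rank hypothesis) transports by `T ↦ χ_2(γ)(1+T) − 1`, the Katz branch of `ψ_W = ψ_{W^{(2)}}·χ̃_2`
being the same translate; (ii) Schneider–Perrin-Riou descent `K^{cyc} → K` (LTYZ Thm 6.1) with ONE new local term at
`v ∣ 2`: `W/K_v` additive, good ordinary over `K_v(√2)` = layer 1 of `K^{cyc}_v` (universal-norm index of `W(K_v)` and
`H¹(Γ_v, W(K^{cyc}_v))(2)`; Perrin-Riou 1992 universal norms [LTYZ ref. 42] replaces Lemma 3.4's `F = K(E_{𝔭²})`, over which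
`W` is NOT good above `2`); (iii) complex + `2`-adic Gross–Zagier as LTYZ Thm 8.2 (stated for POTENTIALLY good ordinary
`p`) and the passage `K → ℚ` of (7.7) with `m_2(W) ∈ {1,…,4}`. Printed inputs beyond `𝔅_split` ⇒ `OfFactsPlus` twin.
Why it might fail: at `p = 2` the bottom-layer local index at the additive `v` meets `W(K_v)[2] ≠ 0` and Tate-duality
parity exactly where LTYZ's (α)/(β) obstructions live; Disegni's `p`-adic GZ [18] must be checked to allow `p = 2`. -/
theorem stub_cyclotomicInternalType :
    (rank_eq_analyticRank_of_analyticRank_le_one ∧ hasEntireLFunction_rat ∧ bsdRHS_eq_of_isIsogenous ∧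
        bsdTriple_of_hasCM_of_L_one_ne_zero ∧ KrizLi2019.thm112_bsdTwo_twist) →
      ∀ (W : WeierstrassCurve ℚ) [W.IsElliptic] [W.IsGloballyMinimal],
        W.analyticRank = 1 → W.j = -3375 → ¬ Good W 2 →
        (∃ (W' : WeierstrassCurve ℚ) (_ : W'.IsElliptic) (_ : W'.IsGloballyMinimal) (C : VariableChange ℚ),
            C • W.quadraticTwist (2 : ℚ) = W' ∧ Good W' 2) →
        BSDp W 2 := by
  sorry

/-- **Stub 3 (the CYCLOTOMIC-EXTERNAL types `d ≡ 3 (mod 4)`, `d ≡ 6 (mod 8)`: the hard half; L-sized / open).**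
Relative to `𝔅_split`: every globally minimal `W` of analytic rank one with `j = −3375`, bad at `2`, whose twist by `−1`
or by `−2` is good at `2`, satisfies `BSD(W,2)`. Here `W` becomes good ordinary above `2` only over `K(μ₄)` resp. `K(√−2)`
— quadratic over `K`, ramified at `2`, NOT inside the `ℤ₂²`-tower of `K` (odd inertia type) but inside `K(μ_{2^∞})`.
Plan: `Δ = Gal(K(μ₄)/K)`-equivariant version of (i)–(iii) of stub 2 over `K(μ_{2^∞}) = K(μ₄)^{cyc}` with `2 = #Δ`
(non-semisimple descent: perfect `Λ[Δ]`-complexes instead of `χ`-parts), fed by the Johnson-Leung–Kings equivariant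
two-variable main conjecture at `2` [LTYZ ref. 32] and a Yager/Coleman identification over a base RAMIFIED at `2`
(author-named as missing: LTYZ Thm 7.2 "F = K if p = 2", [35], [34]); nearest printed input: K. Müller, arXiv:2002.05647
Thm 1.1 (one-variable `𝔭`-adic main conjecture at `2` for every finite abelian `L/K`, `L ⊂ K(𝔣𝔭²)`), with Perrin-Riou's
`𝔭`-adic heights in place of the cyclotomic ones. Why it might fail: the `Δ`-cohomology `Ĥ^i(Δ, X)` is `2`-torsion of
`μ`-type and must be pinned EXACTLY (an error of one factor `2` is the whole statement); no ramified-base Yager theorem is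
in print. This stub is most of the crux by density (3 of the 4 residue classes of `d mod 8`) — declared, not hidden. -/
theorem stub_cyclotomicExternalType :
    (rank_eq_analyticRank_of_analyticRank_le_one ∧ hasEntireLFunction_rat ∧ bsdRHS_eq_of_isIsogenous ∧
        bsdTriple_of_hasCM_of_L_one_ne_zero ∧ KrizLi2019.thm112_bsdTwo_twist) →
      ∀ (W : WeierstrassCurve ℚ) [W.IsElliptic] [W.IsGloballyMinimal],
        W.analyticRank = 1 → W.j = -3375 → ¬ Good W 2 →
        ((∃ (W' : WeierstrassCurve ℚ) (_ : W'.IsElliptic) (_ : W'.IsGloballyMinimal) (C : VariableChange ℚ),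
            C • W.quadraticTwist (-1 : ℚ) = W' ∧ Good W' 2) ∨
          (∃ (W' : WeierstrassCurve ℚ) (_ : W'.IsElliptic) (_ : W'.IsGloballyMinimal) (C : VariableChange ℚ),
            C • W.quadraticTwist (-2 : ℚ) = W' ∧ Good W' 2)) →
        BSDp W 2 := by
  sorry

/-- **Composition (kernel-checked, no `sorry` of its own): the three stubs — used BY NAME — give the crux BY NAME.**
`𝔅_split` supplies Cassels, GZK and modularity for `Theorems.PrintCf2.wAllCornerFTwoSplitBad_iff_maximal` (the `49a2`
partners and the CM-type bookkeeping), stub 1 sorts a `j = −3375` member into its twist type, stubs 2–3 decide each type. -/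
theorem SplitBadTwoRankOneOfFacts_of : SplitBadTwoRankOneOfFacts := by
  intro hB
  have key : Summit.BirchSwinnertonDyer.WAllCornerFTwoSplitBad :=
    (Summit.BirchSwinnertonDyer.BirchSwinnertonDyer.Theorems.PrintCf2.wAllCornerFTwoSplitBad_iff_maximal
        hB.2.2.1 hB.1 hB.2.1).2 fun W _ _ hr hj hg ↦ by
      rcases stub_twistTypeTrichotomy W hj hg with h | h | h
      · exact stub_cyclotomicInternalType hB W hr hj hg h
      · exact stub_cyclotomicExternalType hB W hr hj hg (Or.inl h)
      · exact stub_cyclotomicExternalType hB W hr hj hg (Or.inr h)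
  exact fun W _ _ hcm hr hs hg ↦ key W hcm hr hs hg

end Summit.BirchSwinnertonDyer.BirchSwinnertonDyer.Cruxes.SplitBadTwoRankOneOfFacts.LtyzZeta8Trichotomy
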